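import Summits.BirchSwinnertonDyer.Rank1Residual.O5.HeegnerLogTransportThreeHeegnerIndexEndAnalytic
import Summits.BirchSwinnertonDyer.Rank1Residual.O5.HeegnerLogTransportThreeHeegnerIndexRow2576l1
import HarnessLib
import HarnessLib.Audit.Tags

/-!
# (t′) at `p = 3` — the four SUPERSINGULAR-companion row ENDs of parts 27d/27e in ANALYTIC-RANK CURRENCY
# (`ord_{s=1} L(W/K, s) = ord_{s=1} L(G/K, s) = 1`, Gross–Zagier BY NAME) — o5-r2 GEN 29, part 28b

HONEST FRAMING. Research route; **O5 ((t′): additive potentially-supersingular reduction at an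
anomalous prime) stays OPEN**; conditional on the displayed hypotheses; nothing booked; no
RESIDUAL-MAP mark, label, count or tier moves. NO new mathematics about (t′): the four kernel-certified row ENDs
`o5_index_unit_row439569bw1`, `o5_index_unit_row439569e1` (part 27d, `G = 48841a1`, `d_K = −263`) and
`o5_index_unit_row23184z1`, `o5_index_unit_row162288ei1` (part 27e, `G = 2576l1`, `d_K = −551`) with their two
non-torsion binders `hPinf`, `hP′inf` traded for the ANALYTIC-RANK CURRENCY of part 28: the Gross–Zagier formula
`gross_zagier` BY NAME for `W/K` (level `N`) and for `G/K` (level `N′`) — the binder the two-sided ENDs already carry for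
`G` — and `ord_{s=1} L(W/K, s) = 1`, `ord_{s=1} L(G/K, s) = 1` (`analyticRankEK · K = 1`); NO level binder — `N = N_W`, `N′ = N_G` follow from `hmod` and
`D`, `D′` (Carayol's level theorem in the tree; the kernel numerals `conductorNorm_W… = 439569` etc. of parts 27d/27e
then identify the levels, cf. `level_row439569bw1` below).

What a row END STILL DISPLAYS (honest list): `hKL`, `hmod`, `hGZW`, `hGZG` BY NAME; the Heegner / modular-parametrisation
data (`D`, `D′` at levels `N = N_W`, `N′ = N_G`; `H`, `H′`, `ι`, `ι₃`, `P`, `P′`, `hP`, `hP′`); `han`, `han′` (EVIDENCE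
available: the four `W` are rank-1 curves of the O5 population and the two `G` have a rational point of non-zero canonical
height, the twists by `d_K` have `L(·^{(d_K)}, 1) ≠ 0` (o5-r2 GEN 16 census `kl3_pairs.tsv`, GEN 28 census C rows 4–5:
`ĥ(Y_K) ≠ 0` on `G(K)`) — EVIDENCE, never a Literature fact); `hIdx : 3 ∤ [G(K) : ℤP′_K]` (EVIDENCE: GEN 28 census C,
`HEEGIDX-companion-result.tsv` rows 4–5, `ord₃ index = 0` for (`2576l1`, `−551`) and (`48841a1`, `−263`); not decided in the
tree); `hcD`, `hc3′`.

References: [cite: KrizLi2019, Theorem 1.16 (arXiv:1609.06687v4 pp. 7-8)] [cite: GrossZagier1986, Thm. I.6.3 with V.§2]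
[cite: Gross1991, (1.1)] [cite: CremonaAlgorithms1997, Table 1] [cite: Fisher2012Hessian, Thm. 13.2 (n = 3) and §13]
[cite: KrausOesterle1992, Prop. 3 (i) ⇒ (iii) (pp. 262–263)] [cite: Serre1972, §2.8 Prop. 19 a)]

Typed by `planner-b2b-bsdres-o5-r2-g29-0` (o5-r2 GEN 29, part 28b). Target path
`O5/HeegnerLogTransportThreeHeegnerIndexRowsAnalytic.lean` (NEW leaf; imports part 28 and part 27e ROW, which imports
part 27d ROW). THEOREMS ONLY. Nothing booked.

### cc-typer-5 GEN 21 (O5 §3.5 / O6 §3.4 typer of record) — by-name ask A-O5-G29-1 of o5-r2 GEN 29 (HOME/INBOX.md l.15286 close + P.S. 1 l.15310 + P.S. 2 l.15330; by sha,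
VERBATIM + ¶; memo gen29/O5-GEN29.md) item (e) part 28b REVISED 3d7b014403344cab (P.S. 1: supersedes d08c1017b14b92e2) → O5/HeegnerLogTransportThreeHeegnerIndexRowsAnalytic.lean.
Source: `HOME/b2b-bsdres-o5-r2/gen29/lean/HeegnerLogTransportThreeHeegnerIndexRowsAnalytic.lean` sha16 `3d7b014403344cab` (206 l.; `gen29/SHA16.txt`), re-hashed by the typer
right before writing; THIS file = the source VERBATIM + this paragraph (imports, module text, every declaration block byte-identical; script
`class-closure/typer-5/gen21/gplace21.py`, docstring anchor asserted); imports `O5.HeegnerLogTransportThreeHeegnerIndexEndAnalytic`,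
`O5.HeegnerLogTransportThreeHeegnerIndexRow2576l1` — all ACCEPTED in the tree at filing, but the olean of `O5.HeegnerLogTransportThreeHeegnerIndexRow2576l1` (p375909, accepted
2026-08-25 ≈ 01:50Z) was NOT yet built on the check farm, so NO standalone typer farm check was obtainable (`lean check` answered rc 75 `stale … unbuilt`) and this file is filed
for the gate's own deferral-and-retry; the kernel checks of record are o5-r2's stated farm checks of the identical source (rc 0 / 0 warnings / 0 sorries, axioms standard) and the
gate's verification before acceptance; DEDUP by the typer (`lean search --decl` on the 10 new names: no FQN match, re-run 2026-08-25 01:55Z) plus the gate's statement-level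
dedup. CONTENT LABELS: as the source's module text above states (declarations: `level_row439569bw1`, `level_row439569e1`, `level_row48841a1`, `level_row23184z1`,
`level_row162288ei1`, `level_row2576l1`, `o5_index_unit_row439569bw1_analytic`, `o5_index_unit_row439569e1_analytic`, `o5_index_unit_row23184z1_analytic`,
`o5_index_unit_row162288ei1_analytic`); 0 `@[conjecture]`, 0 Literature facts (net named-fact debt 0), no `sorry`; published inputs stay displayed hypotheses BY NAME, nothing
re-proved. HONEST FRAMING (cell `b2b-bsdres`): research route, lane CLASS-CLOSURE §3.5 O5; CONDITIONAL ENDs — nothing asserted beyond the displayed binders, nothing booked, no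
mark / label / count / tier of `RESIDUAL-MAP.md` moves; census / instrument statements = EVIDENCE or displayed binders, never a Literature fact; O5 OPEN.
-/

noncomputable section

open scoped Classical

open WeierstrassCurve Literature.NumberTheory.EllipticCurves
  Literature.NumberTheory.EllipticCurves.ModularForms
  Literature.NumberTheory.EllipticCurves.Rank1Residual
  Literature.NumberTheory.EllipticCurves.Rank1Residual.Typed
open Summit.BirchSwinnertonDyer.Rank1Residual.Additive.LocalLog
open IsDedekindDomain (HeightOneSpectrum)
open scoped NumberField

namespace Summit.BirchSwinnertonDyer.Rank1Residual.O5.HeegnerLogTransport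

open KL3HeegnerIndexRows

/-! ### The parametrisation levels of the six row curves are FORCED by modularity (no level binder in the ENDs below) -/

/-- `N = 439569` for every modular parametrisation datum of `439569bw1`, given modularity (Carayol's level theorem +
the kernel conductor certificate `conductorNorm_W439569bw1`). [cite: AtkinLehner1970, Thm. 4] [cite: DiamondShurman2005, Thm. 8.8.1] -/
theorem level_row439569bw1 (hmod : exists_isNewformOf) {N : ℕ} [NeZero N]
    (D : ModularParametrizationData W439569bw1 N) : N = 439569 :=
  level_eq_of_conductorNorm_eq hmod D conductorNorm_W439569bw1

/-- `N = 439569` for every modular parametrisation datum of `439569e1`, given modularity (Carayol's level theorem +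
the kernel conductor certificate `conductorNorm_W439569e1`). [cite: AtkinLehner1970, Thm. 4] [cite: DiamondShurman2005, Thm. 8.8.1] -/
theorem level_row439569e1 (hmod : exists_isNewformOf) {N : ℕ} [NeZero N]
    (D : ModularParametrizationData W439569e1 N) : N = 439569 :=
  level_eq_of_conductorNorm_eq hmod D conductorNorm_W439569e1

/-- `N = 48841` for every modular parametrisation datum of `48841a1`, given modularity (Carayol's level theorem +
the kernel conductor certificate `conductorNorm_G48841a1`). [cite: AtkinLehner1970, Thm. 4] [cite: DiamondShurman2005, Thm. 8.8.1] -/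
theorem level_row48841a1 (hmod : exists_isNewformOf) {N : ℕ} [NeZero N]
    (D : ModularParametrizationData G48841a1 N) : N = 48841 :=
  level_eq_of_conductorNorm_eq hmod D conductorNorm_G48841a1

/-- `N = 23184` for every modular parametrisation datum of `23184z1`, given modularity (Carayol's level theorem +
the kernel conductor certificate `conductorNorm_W23184z1`). [cite: AtkinLehner1970, Thm. 4] [cite: DiamondShurman2005, Thm. 8.8.1] -/
theorem level_row23184z1 (hmod : exists_isNewformOf) {N : ℕ} [NeZero N]
    (D : ModularParametrizationData W23184z1 N) : N = 23184 :=
  level_eq_of_conductorNorm_eq hmod D conductorNorm_W23184z1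

/-- `N = 162288` for every modular parametrisation datum of `162288ei1`, given modularity (Carayol's level theorem +
the kernel conductor certificate `conductorNorm_W162288ei1`). [cite: AtkinLehner1970, Thm. 4] [cite: DiamondShurman2005, Thm. 8.8.1] -/
theorem level_row162288ei1 (hmod : exists_isNewformOf) {N : ℕ} [NeZero N]
    (D : ModularParametrizationData W162288ei1 N) : N = 162288 :=
  level_eq_of_conductorNorm_eq hmod D conductorNorm_W162288ei1

/-- `N = 2576` for every modular parametrisation datum of `2576l1`, given modularity (Carayol's level theorem +
the kernel conductor certificate `conductorNorm_G2576l1`). [cite: AtkinLehner1970, Thm. 4] [cite: DiamondShurman2005, Thm. 8.8.1] -/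
theorem level_row2576l1 (hmod : exists_isNewformOf) {N : ℕ} [NeZero N]
    (D : ModularParametrizationData G2576l1 N) : N = 2576 :=
  level_eq_of_conductorNorm_eq hmod D conductorNorm_G2576l1

/-- **THE HEEGNER-INDEX END ON THE ROW `439569bw1 ~ 48841a1` IN ANALYTIC-RANK CURRENCY** — `o5_index_unit_row439569bw1` with
`hPinf`, `hP′inf` from the Gross–Zagier formula BY NAME (`hGZW`, `hGZG`) and `ord_{s=1} L(W/K, s) = ord_{s=1} L(G/K, s) = 1`; no level binder
(modularity + Carayol force the kernel conductor numerals `N = 439569`, `N′ = 48841`; `d_K = -263`). Conditional theorem; research route; O5 OPEN; nothing booked.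
[cite: KrizLi2019, Theorem 1.16 (arXiv:1609.06687v4 pp. 7-8)] [cite: GrossZagier1986, Thm. I.6.3 with V.§2] [cite: Gross1991, (1.1)] -/
theorem o5_index_unit_row439569bw1_analytic
    (hKL : KrizLi2019.thm116_padicLogHeegner_congruence) (hmod : exists_isNewformOf)
    {N N' : ℕ} [NeZero N] [NeZero N']
    (D : ModularParametrizationData W439569bw1 N) (D' : ModularParametrizationData G48841a1 N')
    (K : Type) [Field K] [NumberField K] (hK : IsImaginaryQuadratic K) (hdK : NumberField.discr K = -263)
    (hGZW : gross_zagier N W439569bw1 K) (hGZG : gross_zagier N' G48841a1 K)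
    (hH : SatisfiesHeegnerHypothesis N K) (hH' : SatisfiesHeegnerHypothesis N' K)
    (h3K : SatisfiesHeegnerHypothesis 3 K)
    (H : HeegnerDatum N (NumberField.discr K)) (H' : HeegnerDatum N' (NumberField.discr K))
    (ι : K →+* ℂ) (ι₃ : K →+* ℚ_[3])
    (P : (W439569bw1.baseChange K).toAffine.Point) (P' : (G48841a1.baseChange K).toAffine.Point)
    (hP : WeierstrassCurve.Affine.Point.map ι.toRatAlgHom P = heegnerPointComplex D H)
    (hP' : WeierstrassCurve.Affine.Point.map ι.toRatAlgHom P' = heegnerPointComplex D' H')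
    (han : analyticRankEK W439569bw1 K = 1) (han' : analyticRankEK G48841a1 K = 1)
    (hIdx : ¬ 3 ∣ (AddSubgroup.zmultiples P').index)
    (hcD : padicValInt 3 D.maninConstant = 0) (hc3' : ¬ ((3 : ℤ) ∣ D'.maninConstant)) :
    padicValNat 3 (AddSubgroup.zmultiples P).index = 0 :=
  o5_index_unit_row439569bw1 hKL hmod D D' K hK hdK hH hH' h3K H H' ι ι₃ P P' hP hP'
    ((analyticRankEK_eq_one_iff_heegner_nonTorsion_of_exists_isNewformOf W439569bw1 N K hGZW hmod hK
      (IsNewformOf.level_eq_conductorNorm_of_exists_isNewformOf hmod D.isNewformOf).symm hH ⟨D, H, ι, hP⟩).mp han)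
    ((analyticRankEK_eq_one_iff_heegner_nonTorsion_of_exists_isNewformOf G48841a1 N' K hGZG hmod hK
      (IsNewformOf.level_eq_conductorNorm_of_exists_isNewformOf hmod D'.isNewformOf).symm hH' ⟨D', H', ι, hP'⟩).mp han')
    hIdx hcD hc3'

/-- **THE HEEGNER-INDEX END ON THE ROW `439569e1 ~ 48841a1` IN ANALYTIC-RANK CURRENCY** — `o5_index_unit_row439569e1` with
`hPinf`, `hP′inf` from the Gross–Zagier formula BY NAME (`hGZW`, `hGZG`) and `ord_{s=1} L(W/K, s) = ord_{s=1} L(G/K, s) = 1`; no level binder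
(modularity + Carayol force the kernel conductor numerals `N = 439569`, `N′ = 48841`; `d_K = -263`). Conditional theorem; research route; O5 OPEN; nothing booked.
[cite: KrizLi2019, Theorem 1.16 (arXiv:1609.06687v4 pp. 7-8)] [cite: GrossZagier1986, Thm. I.6.3 with V.§2] [cite: Gross1991, (1.1)] -/
theorem o5_index_unit_row439569e1_analytic
    (hKL : KrizLi2019.thm116_padicLogHeegner_congruence) (hmod : exists_isNewformOf)
    {N N' : ℕ} [NeZero N] [NeZero N']
    (D : ModularParametrizationData W439569e1 N) (D' : ModularParametrizationData G48841a1 N')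
    (K : Type) [Field K] [NumberField K] (hK : IsImaginaryQuadratic K) (hdK : NumberField.discr K = -263)
    (hGZW : gross_zagier N W439569e1 K) (hGZG : gross_zagier N' G48841a1 K)
    (hH : SatisfiesHeegnerHypothesis N K) (hH' : SatisfiesHeegnerHypothesis N' K)
    (h3K : SatisfiesHeegnerHypothesis 3 K)
    (H : HeegnerDatum N (NumberField.discr K)) (H' : HeegnerDatum N' (NumberField.discr K))
    (ι : K →+* ℂ) (ι₃ : K →+* ℚ_[3])
    (P : (W439569e1.baseChange K).toAffine.Point) (P' : (G48841a1.baseChange K).toAffine.Point)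
    (hP : WeierstrassCurve.Affine.Point.map ι.toRatAlgHom P = heegnerPointComplex D H)
    (hP' : WeierstrassCurve.Affine.Point.map ι.toRatAlgHom P' = heegnerPointComplex D' H')
    (han : analyticRankEK W439569e1 K = 1) (han' : analyticRankEK G48841a1 K = 1)
    (hIdx : ¬ 3 ∣ (AddSubgroup.zmultiples P').index)
    (hcD : padicValInt 3 D.maninConstant = 0) (hc3' : ¬ ((3 : ℤ) ∣ D'.maninConstant)) :
    padicValNat 3 (AddSubgroup.zmultiples P).index = 0 :=
  o5_index_unit_row439569e1 hKL hmod D D' K hK hdK hH hH' h3K H H' ι ι₃ P P' hP hP'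
    ((analyticRankEK_eq_one_iff_heegner_nonTorsion_of_exists_isNewformOf W439569e1 N K hGZW hmod hK
      (IsNewformOf.level_eq_conductorNorm_of_exists_isNewformOf hmod D.isNewformOf).symm hH ⟨D, H, ι, hP⟩).mp han)
    ((analyticRankEK_eq_one_iff_heegner_nonTorsion_of_exists_isNewformOf G48841a1 N' K hGZG hmod hK
      (IsNewformOf.level_eq_conductorNorm_of_exists_isNewformOf hmod D'.isNewformOf).symm hH' ⟨D', H', ι, hP'⟩).mp han')
    hIdx hcD hc3'

/-- **THE HEEGNER-INDEX END ON THE ROW `23184z1 ~ 2576l1` IN ANALYTIC-RANK CURRENCY** — `o5_index_unit_row23184z1` with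
`hPinf`, `hP′inf` from the Gross–Zagier formula BY NAME (`hGZW`, `hGZG`) and `ord_{s=1} L(W/K, s) = ord_{s=1} L(G/K, s) = 1`; no level binder
(modularity + Carayol force the kernel conductor numerals `N = 23184`, `N′ = 2576`; `d_K = -551`). Conditional theorem; research route; O5 OPEN; nothing booked.
[cite: KrizLi2019, Theorem 1.16 (arXiv:1609.06687v4 pp. 7-8)] [cite: GrossZagier1986, Thm. I.6.3 with V.§2] [cite: Gross1991, (1.1)] -/
theorem o5_index_unit_row23184z1_analytic
    (hKL : KrizLi2019.thm116_padicLogHeegner_congruence) (hmod : exists_isNewformOf)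
    {N N' : ℕ} [NeZero N] [NeZero N']
    (D : ModularParametrizationData W23184z1 N) (D' : ModularParametrizationData G2576l1 N')
    (K : Type) [Field K] [NumberField K] (hK : IsImaginaryQuadratic K) (hdK : NumberField.discr K = -551)
    (hGZW : gross_zagier N W23184z1 K) (hGZG : gross_zagier N' G2576l1 K)
    (hH : SatisfiesHeegnerHypothesis N K) (hH' : SatisfiesHeegnerHypothesis N' K)
    (h3K : SatisfiesHeegnerHypothesis 3 K)
    (H : HeegnerDatum N (NumberField.discr K)) (H' : HeegnerDatum N' (NumberField.discr K))
    (ι : K →+* ℂ) (ι₃ : K →+* ℚ_[3])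
    (P : (W23184z1.baseChange K).toAffine.Point) (P' : (G2576l1.baseChange K).toAffine.Point)
    (hP : WeierstrassCurve.Affine.Point.map ι.toRatAlgHom P = heegnerPointComplex D H)
    (hP' : WeierstrassCurve.Affine.Point.map ι.toRatAlgHom P' = heegnerPointComplex D' H')
    (han : analyticRankEK W23184z1 K = 1) (han' : analyticRankEK G2576l1 K = 1)
    (hIdx : ¬ 3 ∣ (AddSubgroup.zmultiples P').index)
    (hcD : padicValInt 3 D.maninConstant = 0) (hc3' : ¬ ((3 : ℤ) ∣ D'.maninConstant)) :
    padicValNat 3 (AddSubgroup.zmultiples P).index = 0 :=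
  o5_index_unit_row23184z1 hKL hmod D D' K hK hdK hH hH' h3K H H' ι ι₃ P P' hP hP'
    ((analyticRankEK_eq_one_iff_heegner_nonTorsion_of_exists_isNewformOf W23184z1 N K hGZW hmod hK
      (IsNewformOf.level_eq_conductorNorm_of_exists_isNewformOf hmod D.isNewformOf).symm hH ⟨D, H, ι, hP⟩).mp han)
    ((analyticRankEK_eq_one_iff_heegner_nonTorsion_of_exists_isNewformOf G2576l1 N' K hGZG hmod hK
      (IsNewformOf.level_eq_conductorNorm_of_exists_isNewformOf hmod D'.isNewformOf).symm hH' ⟨D', H', ι, hP'⟩).mp han')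
    hIdx hcD hc3'

/-- **THE HEEGNER-INDEX END ON THE ROW `162288ei1 ~ 2576l1` IN ANALYTIC-RANK CURRENCY** — `o5_index_unit_row162288ei1` with
`hPinf`, `hP′inf` from the Gross–Zagier formula BY NAME (`hGZW`, `hGZG`) and `ord_{s=1} L(W/K, s) = ord_{s=1} L(G/K, s) = 1`; no level binder
(modularity + Carayol force the kernel conductor numerals `N = 162288`, `N′ = 2576`; `d_K = -551`). Conditional theorem; research route; O5 OPEN; nothing booked.
[cite: KrizLi2019, Theorem 1.16 (arXiv:1609.06687v4 pp. 7-8)] [cite: GrossZagier1986, Thm. I.6.3 with V.§2] [cite: Gross1991, (1.1)] -/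
theorem o5_index_unit_row162288ei1_analytic
    (hKL : KrizLi2019.thm116_padicLogHeegner_congruence) (hmod : exists_isNewformOf)
    {N N' : ℕ} [NeZero N] [NeZero N']
    (D : ModularParametrizationData W162288ei1 N) (D' : ModularParametrizationData G2576l1 N')
    (K : Type) [Field K] [NumberField K] (hK : IsImaginaryQuadratic K) (hdK : NumberField.discr K = -551)
    (hGZW : gross_zagier N W162288ei1 K) (hGZG : gross_zagier N' G2576l1 K)
    (hH : SatisfiesHeegnerHypothesis N K) (hH' : SatisfiesHeegnerHypothesis N' K)
    (h3K : SatisfiesHeegnerHypothesis 3 K)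
    (H : HeegnerDatum N (NumberField.discr K)) (H' : HeegnerDatum N' (NumberField.discr K))
    (ι : K →+* ℂ) (ι₃ : K →+* ℚ_[3])
    (P : (W162288ei1.baseChange K).toAffine.Point) (P' : (G2576l1.baseChange K).toAffine.Point)
    (hP : WeierstrassCurve.Affine.Point.map ι.toRatAlgHom P = heegnerPointComplex D H)
    (hP' : WeierstrassCurve.Affine.Point.map ι.toRatAlgHom P' = heegnerPointComplex D' H')
    (han : analyticRankEK W162288ei1 K = 1) (han' : analyticRankEK G2576l1 K = 1)
    (hIdx : ¬ 3 ∣ (AddSubgroup.zmultiples P').index)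
    (hcD : padicValInt 3 D.maninConstant = 0) (hc3' : ¬ ((3 : ℤ) ∣ D'.maninConstant)) :
    padicValNat 3 (AddSubgroup.zmultiples P).index = 0 :=
  o5_index_unit_row162288ei1 hKL hmod D D' K hK hdK hH hH' h3K H H' ι ι₃ P P' hP hP'
    ((analyticRankEK_eq_one_iff_heegner_nonTorsion_of_exists_isNewformOf W162288ei1 N K hGZW hmod hK
      (IsNewformOf.level_eq_conductorNorm_of_exists_isNewformOf hmod D.isNewformOf).symm hH ⟨D, H, ι, hP⟩).mp han)
    ((analyticRankEK_eq_one_iff_heegner_nonTorsion_of_exists_isNewformOf G2576l1 N' K hGZG hmod hK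
      (IsNewformOf.level_eq_conductorNorm_of_exists_isNewformOf hmod D'.isNewformOf).symm hH' ⟨D', H', ι, hP'⟩).mp han')
    hIdx hcD hc3'

end Summit.BirchSwinnertonDyer.Rank1Residual.O5.HeegnerLogTransport

end
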